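import Summits.FinalStateConjecture.FinalStateConjecture.Theses.PhaseMixingCapture
import Summits.FinalStateConjecture.FinalStateConjecture.Theorems.PhaseMixingCaptureCaptureSufficesReduction
import Summits.FinalStateConjecture.FinalStateConjecture.Theorems.PhaseMixingCaptureNearExtremalKappaCaptureBackgroundUniform
import Literature.Geometry.Lorentzian.HorizonPenetratingTeukolsky
import Literature.Geometry.Lorentzian.KerrTimelikeSpan
import HarnessLib

/-!
# Sketch (crux-ideate round 2, ideator 5) — crux `BulkKerrCaptureC2` (stmt-FinalStateConjecture-14985)

First-lemma sheet for two idea cards. NOT a skeleton (no `stub_*`, no `BulkKerrCaptureC2_of`).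

* Card `bounded-kappa-closing-box`: the crux is the bounded-κ output of the route's OWN transfer
  (`PolynomialClosingBox` of line `Cruxes/NearExtremalKappaCapture/Lines/polynomial_closure.lean`,
  convergence order pinned to `2`), fed with the REFEREED bounded-κ Teukolsky slab law
  (`BulkTeukolskySlabLaw`, SR–TdC arXiv:2007.07211 / arXiv:2302.08916 in the tree vocabulary
  `Kerr.TeukolskySlabLawOn`) and the LANDED background bound (p77983). Statements:
  `BulkTeukolskySlabLaw`, `BackgroundBoundAt`/`BackgroundUniform`, `BulkClosingBoxC2`,
  `PolynomialClosingBoxC2`; first lemma `bulkKerrCaptureC2_of_bulkClosingBox`.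
* Card `killing-shell-packets`: DHRT arXiv:2410.03639 wave-packet mechanism at bounded κ; first
  lemma `UniformKillingShells` (quantitative, shell-uniform DRSR Lemma 4.7.1) and the packet
  transfer `PacketClosingBoxC2` that consumes it.
-/

set_option linter.dupNamespace false

noncomputable section

open Set Filter
open scoped Manifold ENNReal ContDiff Topology

namespace Summit.FinalStateConjecture.FinalStateConjecture.Cruxes.BulkKerrCaptureC2.Ideator5

open Literature.Geometry.Lorentzian
open Summit.FinalStateConjecture.FinalStateConjecture.Theses.PhaseMixingCapture (BulkKerrCaptureC2)
open Summit.FinalStateConjecture.FinalStateConjecture.Theorems.BulkKerrCapture.Negative (CaptureAt)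
open Summit.FinalStateConjecture.FinalStateConjecture.Theorems.PhaseMixingCaptureCaptureSuffices
  (bulkKerrCaptureC2_of_captureAt_two)

/-! ## Card 1 — `bounded-kappa-closing-box` -/

/-- **Bounded-κ Teukolsky slab law** (the linear black box of the bulk, REFEREED TARGET:
Shlapentokh-Rothman–Teixeira da Costa, boundedness and decay for the Teukolsky equation on Kerr in
the full sub-extremal range, frequency space arXiv:2007.07211 + physical space arXiv:2302.08916,
Thm A). For every threshold `a₁ < 1` there is ONE regularity `(k, w)` such that for every mass scale
`M₀ > 0` and radius `R` there is a constant `C = C(a₁, M₀, R) ≥ 1` giving the DHRT (1.3)-format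
slab law `Kerr.TeukolskySlabLawOn M a M k w R C` (sourced spin-±2 pairs on the horizon-penetrating
chart `{r > M}`) for every mass `M ∈ [M₀/2, 2M₀]` and every spin `|a| ≤ a₁ M`. No rate in
`1 − |a|/M` is asked (that is the sibling crux `KappaExplicitWaveDecay` at spin ±2); uniformity on
the COMPACT spin set is the structure of the SR–TdC continuity argument in `a`. -/
def BulkTeukolskySlabLaw : Prop :=
  ∀ [Kerr.Facts], ∀ a₁ : ℝ, a₁ < 1 → ∃ (k : ℕ) (w : ℝ),
    ∀ M₀ : ℝ, 0 < M₀ → ∀ R : ℝ, ∃ C : ℝ, 1 ≤ C ∧ ∀ M : ℝ, M₀ / 2 ≤ M → M ≤ 2 * M₀ →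
      ∀ a : ℝ, |a| ≤ a₁ * M → Kerr.TeukolskySlabLawOn M a M k w R C

/-- **Background bound at one spin** — verbatim `BackgroundBoundAt` of the polynomial-closure line
(leg β): on `{x⁰ = 0, M ≤ r_a(x) ≤ R}` every joint `(a, x)`-derivative of order `≤ n` of the
Kerr–Schild scalar `H` and null covector `ℓ` has norm `≤ B`. -/
def BackgroundBoundAt (M a : ℝ) (n : ℕ) (R B : ℝ) : Prop :=
  ∀ x : E4, x 0 = 0 → M ≤ Kerr.radius a x → Kerr.radius a x ≤ R → ∀ j : ℕ, j ≤ n →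
    ‖iteratedFDeriv ℝ j (fun q : ℝ × E4 ↦ Kerr.scalarH M q.1 q.2) (a, x)‖ ≤ B ∧
      ∀ μ : Fin 4, ‖iteratedFDeriv ℝ j (fun q : ℝ × E4 ↦ Kerr.nullCovectorFun q.1 q.2 μ) (a, x)‖ ≤ B

/-- **`BackgroundUniform`** (leg β; LANDED p77983 as
`Theorems.NearExtremalKappaCapture.PolynomialClosure.stub_backgroundUniform`). -/
def BackgroundUniform : Prop :=
  ∀ M : ℝ, 0 < M → ∀ (n : ℕ) (R : ℝ), ∃ B : ℝ, 1 ≤ B ∧ ∀ a : ℝ, |a| ≤ M →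
    BackgroundBoundAt M a n R B

/-- `BackgroundUniform` holds (the landed theorem, definitional unfolding). -/
theorem backgroundUniform_holds : BackgroundUniform :=
  Theorems.NearExtremalKappaCapture.PolynomialClosure.stub_backgroundUniform

/-- **Bulk closing box at order two** — the nonlinear transfer the crux needs and NOTHING MORE:
for every linear regularity `(k, w)` and threshold `a₁ < 1` there are data exponents `(s, δ)` such
that for every mass `M > 0` there are `(R, n)` (where the law and the background bound are read)
with: for all constants `Λ, B ≥ 1` there are ONE basin `ε > 0` and ONE Lipschitz constant `C`
serving every spin `|a| ≤ a₁ M` — granted the slab law with constant `Λ` on the parameter box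
`|M' − M| + |a' − a| ≤ Mχ/8` (`χ = 1 − (a/M)²`, the box of the registered transfer) and the
background bound `B`, `C²`-capture `CaptureAt s δ 2 M _ ε C a` holds (basin `ε`, far-complete 𝓘⁺,
a region converging in `C²` to a sub-extremal Kerr, modulus `C √dist`). This is the Einstein-vacuum
analogue, at bounded surface gravity, of the black-box theorem of DHRT arXiv:2212.14093 /
arXiv:2410.03639 (quasilinear waves, full sub-extremal range); it is IMPLIED by the registered
κ-tracked transfer `PolynomialClosingBox` with `kc := 2` (`bulkClosingBoxC2_of_polynomial`). -/
def BulkClosingBoxC2 : Prop :=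
  ∀ [Kerr.Facts] [Kerr.SliceFacts], ∀ (k : ℕ) (w : ℝ), ∀ a₁ : ℝ, a₁ < 1 → ∃ (s : ℕ) (δ : ℝ),
    ∀ (M : ℝ) (hM : 0 < M), ∃ (R : ℝ) (n : ℕ), ∀ Λ B : ℝ, 1 ≤ Λ → 1 ≤ B →
      ∃ ε > (0 : ℝ), ∃ C : ℝ, ∀ a : ℝ, |a| ≤ a₁ * M →
        (∀ M' a' : ℝ, |M' - M| + |a' - a| ≤ M * (1 - (a / M) ^ 2) / 8 →
            Kerr.TeukolskySlabLawOn M' a' M' k w R Λ) →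
        BackgroundBoundAt M a n R B →
        CaptureAt s δ 2 M hM.le ε C a

/-- **The registered transfer with the convergence order pinned** — `PolynomialClosingBox` of
`Cruxes/NearExtremalKappaCapture/Lines/polynomial_closure.lean` (stub 3″, triage r1 3 × pass) with
`kc := 2` (the route's TWO-LAYER PLAN: "leads should already state kc := 2") and the far clause in
the `HasCompleteFutureNullInfinityFar` form of `Negative.CaptureAt`. -/
def PolynomialClosingBoxC2 : Prop :=
  ∀ [Kerr.Facts] [Kerr.SliceFacts], ∀ (k : ℕ) (w : ℝ),
    ∃ (s : ℕ) (δ : ℝ) (N : ℕ) (γ₀ : ℝ), ∀ (M : ℝ) (hM : 0 < M),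
      ∃ (R : ℝ) (n : ℕ) (c₀ : ℝ), 0 < c₀ ∧ ∃ C₀ : ℝ, 0 ≤ C₀ ∧
        ∀ a : ℝ, Kerr.IsSubextremal M a → ∀ Λ B : ℝ, 1 ≤ Λ → 1 ≤ B →
          (∀ M' a' : ℝ, |M' - M| + |a' - a| ≤ M * (1 - (a / M) ^ 2) / 8 →
              Kerr.TeukolskySlabLawOn M' a' M' k w R Λ) →
            BackgroundBoundAt M a n R B →
              CaptureAt s δ 2 M hM.le (c₀ * (1 - (a / M) ^ 2) ^ γ₀ * ((Λ * B) ^ N)⁻¹)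
                (C₀ * (1 - (a / M) ^ 2) ^ (-γ₀) * (Λ * B) ^ N) a

/-- The κ-tracked transfer at `kc := 2` implies the bulk box: on `|a| ≤ a₁ M` one has
`χ ≥ 1 − a₁²`, so basin and modulus are bounded by the values at `χ₁ := 1 − a₁²` (or at `χ = 1`,
according to the sign of `γ₀`). Bookkeeping only. -/
theorem captureAt_mono' [Kerr.Facts] [Kerr.SliceFacts] {s : ℕ} {δ : ℝ} {k : ℕ} {M : ℝ}
    {hM : 0 ≤ M} {a ε ε' C C' : ℝ} (h : CaptureAt s δ k M hM ε C a) (hε : ε' ≤ ε) (hC : C ≤ C') :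
    CaptureAt s δ k M hM ε' C' a := by
  intro D _ hvac hdist 𝒟 hmax
  obtain ⟨M', a', 𝒟oc, hsub, hfar, hconv, hmod⟩ :=
    h D hvac (hdist.trans_le (ENNReal.ofReal_le_ofReal hε)) 𝒟 hmax
  exact ⟨M', a', 𝒟oc, hsub, hfar, hconv,
    hmod.trans (mul_le_mul_of_nonneg_right hC (Real.sqrt_nonneg _))⟩

theorem bulkClosingBoxC2_of_polynomial (h : PolynomialClosingBoxC2) : BulkClosingBoxC2 := by
  intro _ _ k w a₁ ha₁
  obtain ⟨s, δ, N, γ₀, hM⟩ := h k w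
  refine ⟨s, δ, fun M hMpos ↦ ?_⟩
  obtain ⟨R, n, c₀, hc₀, C₀, hC₀, hbox⟩ := hM M hMpos
  refine ⟨R, n, fun Λ B hΛ hB ↦ ?_⟩
  rcases lt_or_ge a₁ 0 with hneg | h0
  · refine ⟨1, one_pos, 0, fun a ha ↦ ?_⟩
    exfalso
    have : |a| < 0 := ha.trans_lt (mul_neg_of_neg_of_pos hneg hMpos)
    exact absurd this (not_lt.2 (abs_nonneg a))
  · set χ₁ : ℝ := 1 - a₁ ^ 2 with hχ₁
    have hχ₁0 : 0 < χ₁ := by rw [hχ₁]; nlinarith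
    set m : ℝ := min 1 (χ₁ ^ γ₀) with hm
    set m' : ℝ := max 1 (χ₁ ^ (-γ₀)) with hm'
    have hm0 : 0 < m := lt_min one_pos (Real.rpow_pos_of_pos hχ₁0 _)
    have hΛB : 0 < (Λ * B) ^ N := pow_pos (mul_pos (by linarith) (by linarith)) N
    refine ⟨c₀ * m * ((Λ * B) ^ N)⁻¹, by positivity, C₀ * m' * (Λ * B) ^ N,
      fun a ha hlaw hbg ↦ ?_⟩
    have haM : |a| < M := lt_of_le_of_lt ha (by nlinarith)
    have hsub : Kerr.IsSubextremal M a := haM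
    have ht : (a / M) ^ 2 ≤ a₁ ^ 2 := by
      rw [div_pow, div_le_iff₀ (by positivity), ← sq_abs a]
      have : |a| ^ 2 ≤ (a₁ * M) ^ 2 := pow_le_pow_left₀ (abs_nonneg a) ha 2
      nlinarith
    have hχlo : χ₁ ≤ 1 - (a / M) ^ 2 := by rw [hχ₁]; linarith
    have hχhi : 1 - (a / M) ^ 2 ≤ 1 := by nlinarith [sq_nonneg (a / M)]
    have hχ0 : 0 < 1 - (a / M) ^ 2 := hχ₁0.trans_le hχlo
    have hbasin : m ≤ (1 - (a / M) ^ 2) ^ γ₀ := by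
      rcases le_or_gt 0 γ₀ with hγ | hγ
      · exact (min_le_right _ _).trans (Real.rpow_le_rpow hχ₁0.le hχlo hγ)
      · calc m ≤ 1 := min_le_left _ _
          _ = (1 : ℝ) ^ γ₀ := (Real.one_rpow _).symm
          _ ≤ (1 - (a / M) ^ 2) ^ γ₀ := Real.rpow_le_rpow_of_nonpos hχ0 hχhi hγ.le
    have hmod : (1 - (a / M) ^ 2) ^ (-γ₀) ≤ m' := by
      rcases le_or_gt 0 γ₀ with hγ | hγ
      · exact (Real.rpow_le_rpow_of_nonpos hχ₁0 hχlo (neg_nonpos.2 hγ)).trans (le_max_right _ _)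
      · calc (1 - (a / M) ^ 2) ^ (-γ₀) ≤ (1 : ℝ) ^ (-γ₀) :=
              Real.rpow_le_rpow hχ0.le hχhi (by linarith)
          _ = 1 := Real.one_rpow _
          _ ≤ m' := le_max_left _ _
    have hcap := hbox a hsub Λ B hΛ hB hlaw hbg
    refine captureAt_mono' hcap ?_ ?_
    · have : c₀ * m ≤ c₀ * (1 - (a / M) ^ 2) ^ γ₀ := mul_le_mul_of_nonneg_left hbasin hc₀.le
      exact mul_le_mul_of_nonneg_right this (inv_nonneg.2 hΛB.le)
    · have : C₀ * (1 - (a / M) ^ 2) ^ (-γ₀) ≤ C₀ * m' := mul_le_mul_of_nonneg_left hmod hC₀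
      exact mul_le_mul_of_nonneg_right this hΛB.le

/-- The box of the transfer stays inside a compact sub-extremal spin set: if `0 < M`, `|a| ≤ a₁M`,
`0 ≤ a₁ < 1` and `|M' − M| + |a' − a| ≤ M(1 − (a/M)²)/8` then `M/2 ≤ M' ≤ 2M` and
`|a'| ≤ a₂ M'` with `a₂ := (8a₁ + 1 − a₁²)/(7 + a₁²)`... we only record the qualitative form
needed by the composition: `|a'| ≤ √((2 + a₁²)/3) · M'` (from `χ' ≥ χ/3`, the `box_bounds` lemma
of the polynomial-closure line). -/
theorem box_threshold {M a M' a' a₁ : ℝ} (hM : 0 < M) (ha₁ : 0 ≤ a₁) (ha₁' : a₁ < 1)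
    (ha : |a| ≤ a₁ * M) (hbox : |M' - M| + |a' - a| ≤ M * (1 - (a / M) ^ 2) / 8) :
    M / 2 ≤ M' ∧ M' ≤ 2 * M ∧ |a'| ≤ √((2 + a₁ ^ 2) / 3) * M' := by
  -- adapted from `box_bounds` of Cruxes/NearExtremalKappaCapture/Lines/polynomial_closure.lean
  have haM : |a| < M := lt_of_le_of_lt ha (by nlinarith)
  set u : ℝ := M - |a| with hu
  have hu0 : 0 < u := by rw [hu]; linarith
  have hchi : M * (1 - (a / M) ^ 2) = u * ((M + |a|) / M) := by
    rw [hu, div_pow, ← sq_abs a]; field_simp; ring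
  have hchi2 : M * (1 - (a / M) ^ 2) ≤ 2 * u := by
    rw [hchi]
    have : (M + |a|) / M ≤ 2 := by rw [div_le_iff₀ hM]; linarith
    exact (mul_le_mul_of_nonneg_left this hu0.le).trans_eq (by ring)
  have hd : |M' - M| + |a' - a| ≤ u / 4 := by linarith
  have hM'lo : M - u / 4 ≤ M' := by linarith [neg_abs_le (M' - M), abs_nonneg (a' - a)]
  have hM'hi : M' ≤ M + u / 4 := by linarith [le_abs_self (M' - M), abs_nonneg (a' - a)]
  have huM : u ≤ M := by rw [hu]; linarith [abs_nonneg a]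
  have hM'pos : 0 < M' := by linarith
  have ht : (a / M) ^ 2 ≤ a₁ ^ 2 := by
    rw [div_pow, div_le_iff₀ (by positivity), ← sq_abs a]
    have : |a| ^ 2 ≤ (a₁ * M) ^ 2 := pow_le_pow_left₀ (abs_nonneg a) ha 2
    nlinarith
  have hχ0 : 0 ≤ 1 - (a / M) ^ 2 := by nlinarith
  have hM'le : M' ≤ 9 / 8 * M := by
    have e1 : M * (1 - (a / M) ^ 2) / 8 ≤ M / 8 := by nlinarith [sq_nonneg (a / M)]
    have e2 : |M' - M| ≤ M / 8 := by linarith [abs_nonneg (a' - a)]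
    linarith [le_abs_self (M' - M)]
  have hgap : 3 * u / 4 ≤ M' - |a'| := by
    have e1 : |a'| ≤ |a| + |a' - a| := by
      calc |a'| = |a + (a' - a)| := by ring_nf
        _ ≤ |a| + |a' - a| := abs_add_le _ _
    have e2 := neg_abs_le (M' - M)
    rw [hu]
    linarith
  refine ⟨by linarith, by linarith, ?_⟩
  have hchi' : (M' - |a'|) / M' ≤ 1 - (a' / M') ^ 2 := by
    rw [div_pow, ← sq_abs a', div_le_iff₀ hM'pos]
    have ha'0 : 0 ≤ |a'| := abs_nonneg a'
    have hlt : |a'| < M' := by linarith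
    have e : (1 - |a'| ^ 2 / M' ^ 2) * M' = (M' - |a'|) * ((M' + |a'|) / M') := by
      field_simp; ring
    rw [e]
    have : 1 ≤ (M' + |a'|) / M' := by rw [le_div_iff₀ hM'pos]; linarith
    exact le_mul_of_one_le_right (by linarith) this
  have hstep : (1 - (a / M) ^ 2) / 3 ≤ (M' - |a'|) / M' := by
    rw [div_le_div_iff₀ (by norm_num : (0:ℝ) < 3) hM'pos]
    have e0 : (1 - (a / M) ^ 2) * M ≤ 2 * u := by linarith [hchi2]
    have e1 : (1 - (a / M) ^ 2) * M' ≤ (1 - (a / M) ^ 2) * (9 / 8 * M) :=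
      mul_le_mul_of_nonneg_left hM'le hχ0
    linarith
  have hsq : (a' / M') ^ 2 ≤ (2 + a₁ ^ 2) / 3 := by linarith [hstep.trans hchi']
  have habs : |a' / M'| ≤ √((2 + a₁ ^ 2) / 3) := by
    rw [← Real.sqrt_sq_eq_abs]
    exact Real.sqrt_le_sqrt hsq
  rw [abs_div, abs_of_pos hM'pos, div_le_iff₀ hM'pos] at habs
  exact habs

/-- **FIRST LEMMA of card `bounded-kappa-closing-box`**: the bounded-κ slab law, the landed
background bound and the bulk closing box give the crux — through the `k := 2` member of the
`BulkKerrCapture` family and the LANDED `bulkKerrCaptureC2_of_captureAt_two` (the b-conormal side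
condition of the crux is not used; `∀ η ∃ ε` follows from the Lipschitz modulus). -/
theorem bulkKerrCaptureC2_of_bulkClosingBox (hL : BulkTeukolskySlabLaw) (hβ : BackgroundUniform)
    (hT : BulkClosingBoxC2) : BulkKerrCaptureC2 := by
  refine bulkKerrCaptureC2_of_captureAt_two ?_
  intro _ _ a₁ ha₁
  rcases lt_or_ge a₁ 0 with hneg | h0
  · refine ⟨0, 0, fun M hM ↦ ⟨1, one_pos, 0, fun a ha ↦ ?_⟩⟩
    exfalso
    have : |a| < 0 := ha.trans_lt (mul_neg_of_neg_of_pos hneg hM)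
    exact absurd this (not_lt.2 (abs_nonneg a))
  · -- the law is consumed on the parameter boxes, i.e. up to the enlarged threshold `a₂ < 1`
    set a₂ : ℝ := √((2 + a₁ ^ 2) / 3) with ha₂
    have ha₂lt : a₂ < 1 := by
      rw [ha₂, Real.sqrt_lt' one_pos]
      nlinarith
    obtain ⟨k, w, hlaw⟩ := hL a₂ ha₂lt
    obtain ⟨s, δ, hsδ⟩ := hT k w a₁ ha₁
    refine ⟨s, δ, fun M hM ↦ ?_⟩
    obtain ⟨R, n, hRn⟩ := hsδ M hM
    obtain ⟨CL, hCL1, hCL⟩ := hlaw M hM R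
    obtain ⟨B, hB1, hB⟩ := hβ M hM n R
    obtain ⟨ε, hε, C, hC⟩ := hRn CL B hCL1 hB1
    refine ⟨ε, hε, C, fun a ha ↦ hC a ha ?_ ?_⟩
    · intro M' a' hbox
      obtain ⟨hlo, hhi, ha'⟩ := box_threshold hM h0 ha₁ ha hbox
      exact hCL M' hlo hhi a' ha'
    · exact hB a (ha.trans (by nlinarith))

/-! ## Card 2 — `killing-shell-packets` -/

/-- The constant-coefficient Killing combination `T + c Φ = ∂₀ + c (x₁∂₂ − x₂∂₁)` at `x`. -/
def killingComb (c : ℝ) (x : E4) : E4 := E4.basisVector 0 + c • Kerr.axialVector x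

/-- **Timelike Killing shells at one spin.** On every shell `{|r_a(x) − r₀| ≤ d·M}` centred at a
radius `r₀ ∈ [r₊ + c₁M, R·M]`, the CONSTANT Killing field `T + ω(r₀)Φ`
(`ω = Kerr.drsrAngularVelocity`, DRSR Lemma 4.7.1's profile frozen at the centre of the shell) is
uniformly timelike: `g(V, V) ≤ −μ`. -/
def ShellsAt (M a c₁ R d μ : ℝ) : Prop :=
  ∀ r₀ : ℝ, Kerr.rPlus M a + c₁ * M ≤ r₀ → r₀ ≤ R * M →
    ∀ x : E4, |Kerr.radius a x - r₀| ≤ d * M →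
      Kerr.bilin M a x (killingComb (Kerr.drsrAngularVelocity M a r₀) x)
          (killingComb (Kerr.drsrAngularVelocity M a r₀) x) ≤ -μ

/-- **FIRST LEMMA of card `killing-shell-packets` — uniform timelike Killing shells at bounded
surface gravity.** For every threshold `a₁ < 1`, inner margin `c₁ > 0` and outer radius `R` there
are a shell width `d > 0` and a timelike margin `μ > 0`, BOTH INDEPENDENT OF `(M, a)`, such that
`ShellsAt M a c₁ R d μ` for every `M > 0` and `|a| ≤ a₁ M`. Quantitative, shell-uniform form of
DRSR arXiv:1402.7034 Lemma 4.7.1 (tree: `Kerr.bilin_drsrVector_neg`, pointwise) = the geometric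
input "an r-interval sufficiently small to admit a timelike Killing field ∂_{t*} + α_n ∂_{φ*}" of
DHRT arXiv:2410.03639 §1 / §2.1.2; scale-invariant, so `d, μ` do not depend on `M`. Provable by
compactness of `{|a| ≤ a₁} × {shell} × {r₀-range}` at `M = 1` plus scaling. -/
def UniformKillingShells : Prop :=
  ∀ a₁ : ℝ, a₁ < 1 → ∀ c₁ R : ℝ, 0 < c₁ → ∃ d > (0 : ℝ), ∃ μ > (0 : ℝ),
    ∀ M : ℝ, 0 < M → ∀ a : ℝ, |a| ≤ a₁ * M → ShellsAt M a c₁ R d μ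

/-- **Packet closing box at order two** (the nonlinear stub of card 2): the bulk closing box with
the shell data `(c₁, d, μ)` as an INPUT — the (t*, φ*)-wave-packet top-order currents of DHRT
arXiv:2410.03639 are built shell by shell from the timelike Killing fields, so the number of
packets and every constant depend on `(d, μ)` only. -/
def PacketClosingBoxC2 : Prop :=
  ∀ [Kerr.Facts] [Kerr.SliceFacts], ∀ (k : ℕ) (w : ℝ), ∀ a₁ : ℝ, a₁ < 1 → ∃ (s : ℕ) (δ : ℝ),
    ∀ (M : ℝ) (hM : 0 < M), ∃ (R : ℝ) (n : ℕ) (c₁ : ℝ), 0 < c₁ ∧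
      ∀ d μ Λ B : ℝ, 0 < d → 0 < μ → 1 ≤ Λ → 1 ≤ B →
        ∃ ε > (0 : ℝ), ∃ C : ℝ, ∀ a : ℝ, |a| ≤ a₁ * M →
          ShellsAt M a c₁ R d μ →
          (∀ M' a' : ℝ, |M' - M| + |a' - a| ≤ M * (1 - (a / M) ^ 2) / 8 →
              Kerr.TeukolskySlabLawOn M' a' M' k w R Λ) →
          BackgroundBoundAt M a n R B →
          CaptureAt s δ 2 M hM.le ε C a

/-- **Shell centres are timelike (the `d = 0` case of `ShellsAt`) — DRSR Lemma 4.7.1 from the tree.**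
At a point of radius EXACTLY `r₀ > r₊` the frozen field `T + ω(r₀)Φ` is the DRSR field, hence
timelike (`Kerr.bilin_drsrVector_neg`): the first lemma `UniformKillingShells` is its quantitative,
shell-uniform thickening. Also certifies the sign convention (`bilin … ≤ −μ` = timelike). -/
theorem shellCentre_timelike {M a r₀ : ℝ} (hMa : Kerr.IsSubextremal M a) {x : E4}
    (hx : Kerr.radius a x = r₀) (hr : Kerr.rPlus M a < r₀) :
    Kerr.bilin M a x (killingComb (Kerr.drsrAngularVelocity M a r₀) x)
        (killingComb (Kerr.drsrAngularVelocity M a r₀) x) < 0 := by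
  have h := Kerr.bilin_drsrVector_neg hMa (x := x) (by rw [hx]; exact hr)
  simpa only [killingComb, Kerr.drsrVector, hx] using h

/-- In particular `ShellsAt M a c₁ R 0 μ` forces nothing false at its centres: with `d = 0` the
shell is the sphere `{r = r₀}` and the field is strictly timelike there for every `|a| < M`,
`r₀ ≥ r₊ + c₁M > r₊`. -/
example {M a c₁ r₀ : ℝ} (hM : 0 < M) (hMa : Kerr.IsSubextremal M a) (hc₁ : 0 < c₁)
    (hr₀ : Kerr.rPlus M a + c₁ * M ≤ r₀) {x : E4} (hx : Kerr.radius a x = r₀) :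
    Kerr.bilin M a x (killingComb (Kerr.drsrAngularVelocity M a r₀) x)
        (killingComb (Kerr.drsrAngularVelocity M a r₀) x) < 0 :=
  shellCentre_timelike hMa hx (lt_of_lt_of_le (by nlinarith) hr₀)

/-- The packet box and uniform shells give the bulk box (bookkeeping: read `(d, μ)` off
`UniformKillingShells` at `(a₁, c₁, R)`). -/
theorem bulkClosingBoxC2_of_packets (hS : UniformKillingShells) (hP : PacketClosingBoxC2) :
    BulkClosingBoxC2 := by
  intro _ _ k w a₁ ha₁
  obtain ⟨s, δ, hsδ⟩ := hP k w a₁ ha₁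
  refine ⟨s, δ, fun M hM ↦ ?_⟩
  obtain ⟨R, n, c₁, hc₁, hbox⟩ := hsδ M hM
  obtain ⟨d, hd, μ, hμ, hshell⟩ := hS a₁ ha₁ c₁ R hc₁
  refine ⟨R, n, fun Λ B hΛ hB ↦ ?_⟩
  obtain ⟨ε, hε, C, hC⟩ := hbox d μ Λ B hd hμ hΛ hB
  exact ⟨ε, hε, C, fun a ha hlaw hbg ↦ hC a ha (hshell M hM a ha) hlaw hbg⟩

/-- Card 2 end to end (modulo the first lemma of card 1). -/
theorem bulkKerrCaptureC2_of_packets (hS : UniformKillingShells) (hL : BulkTeukolskySlabLaw)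
    (hP : PacketClosingBoxC2) : BulkKerrCaptureC2 :=
  bulkKerrCaptureC2_of_bulkClosingBox hL backgroundUniform_holds (bulkClosingBoxC2_of_packets hS hP)

end Summit.FinalStateConjecture.FinalStateConjecture.Cruxes.BulkKerrCaptureC2.Ideator5

end
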